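import Literature.Geometry.Kaehler.TorusTransferOps
import HarnessLib

/-!
# Transfer of function multiples: `T(ρ β) = ρ̃ · T(β)` (Warner 6.33)

F. W. Warner, GTM 94 (1983), 6.33: the cut-offs `φ_j α`, `φ α` are transferred to the torus, where
multiplication by a smooth function becomes multiplication by a smooth periodic function `ρ̃`
(the cut-off periodisation of `ρ ∘ e⁻¹ ∘ Φ⁻¹`), whose Fourier side is the scalar convolution
`scal(𝓕ρ̃) ⋆` of the lattice calculus. We define `CubeCutoff.torusFun 𝒞 ρ = ρ̃`, prove it smooth
(`isSmooth_torusFun`) and the identity `MForm.toTorus p A ι (ρ • β) = ρ̃ • MForm.toTorus p A ι β`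
for forms supported in the chart preimage of the inner cube region (`MForm.toTorus_fun_smul`),
with the bound `|ρ̃| ≤ sup |ρ|` (`norm_torusFun_le`).

## References

* F. W. Warner, GTM 94 (1983), 6.33. [WarnerGTM94]
-/

noncomputable section

open scoped Manifold ContDiff Topology
open Bundle Set Function Metric
open Literature.Analysis.FunctionSpaces

namespace Literature.Geometry.Kaehler

variable {E : Type*} [NormedAddCommGroup E] [NormedSpace ℝ E] {n : ℕ}
  {M : Type*} [TopologicalSpace M] [ChartedSpace E M] [IsManifold 𝓘(ℝ, E) ∞ M]
  {F : Type*} [NormedAddCommGroup F] [NormedSpace ℝ F] {k : ℕ}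
  {V : Type*} [NormedAddCommGroup V] [NormedSpace ℂ V]
  {p : M} {A : E ≃L[ℝ] EuclideanSpace ℝ (Fin n)} (𝒞 : CubeCutoff p A)

/-- The cut-off chart reading of a function on `ℝⁿ`: `z ↦ χ(z) ρ(e⁻¹(Φ⁻¹ z))`, complex-valued.
[cite: WarnerGTM94, 6.33] -/
def CubeCutoff.funAux (ρ : M → ℝ) : EuclideanSpace ℝ (Fin n) → ℂ := fun z ↦
  𝒞.χ z • ((ρ ((extChartAt 𝓘(ℝ, E) p).symm ((cubeMap A (extChartAt 𝓘(ℝ, E) p p)).symm z)) : ℝ) : ℂ)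

/-- **The periodic function `ρ̃` of a function `ρ` on `M`** (cut-off chart reading, periodised).
[cite: WarnerGTM94, 6.33] -/
def CubeCutoff.torusFun (ρ : M → ℝ) : UnitAddTorus (Fin n) → ℂ := Torus.periodize (𝒞.funAux ρ)

omit [IsManifold 𝓘(ℝ, E) ∞ M] in
/-- `ρ̃` at `x` is the cut-off chart reading at the cube representative. [folklore] -/
theorem CubeCutoff.torusFun_apply (ρ : M → ℝ) (x : UnitAddTorus (Fin n)) :
    𝒞.torusFun ρ x = 𝒞.χ (Torus.repr x) •
      ((ρ ((extChartAt 𝓘(ℝ, E) p).symm ((cubeMap A (extChartAt 𝓘(ℝ, E) p p)).symm (Torus.repr x))) : ℝ) : ℂ) :=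
  Torus.periodize_eq_apply_repr (fun z hz ↦ by simp [CubeCutoff.funAux, 𝒞.eq_zero_of_not hz]) x

omit [IsManifold 𝓘(ℝ, E) ∞ M] in
/-- `|ρ̃| ≤ sup |ρ|`. [folklore] -/
theorem CubeCutoff.norm_torusFun_le (ρ : M → ℝ) {c : ℝ} (hρ : ∀ x, |ρ x| ≤ c)
    (x : UnitAddTorus (Fin n)) : ‖𝒞.torusFun ρ x‖ ≤ c := by
  rw [𝒞.torusFun_apply, norm_smul, Complex.norm_real, Real.norm_eq_abs, Real.norm_eq_abs]
  exact (mul_le_mul (𝒞.abs_le _) (hρ _) (abs_nonneg _) zero_le_one).trans_eq (one_mul c)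

/-- `ρ̃` is smooth for smooth `ρ`. [folklore] -/
theorem CubeCutoff.isSmooth_torusFun {ρ : M → ℝ} (hρ : ContMDiff 𝓘(ℝ, E) 𝓘(ℝ) ∞ ρ) :
    Torus.IsSmooth (𝒞.torusFun ρ) := by
  have h1 : ContDiffOn ℝ ∞ (fun y ↦ ((ρ ((extChartAt 𝓘(ℝ, E) p).symm y) : ℝ) : ℂ)) (extChartAt 𝓘(ℝ, E) p).target := by
    have h2 : ContMDiffOn 𝓘(ℝ, E) 𝓘(ℝ) ∞ (ρ ∘ (extChartAt 𝓘(ℝ, E) p).symm) (extChartAt 𝓘(ℝ, E) p).target :=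
      hρ.comp_contMDiffOn (contMDiffOn_extChartAt_symm p)
    exact Complex.ofRealCLM.contDiff.comp_contDiffOn (contMDiffOn_iff_contDiffOn.1 h2)
  have hs : ContDiff ℝ ∞ (𝒞.funAux ρ) :=
    contDiff_smul_of_tsupport_subset (CubeCutoff.isOpen_preimage_target p A) 𝒞.contDiff
      𝒞.tsupport_subset_preimage (h1.comp (contDiff_cubeMap_symm A _).contDiffOn fun _ hz ↦ hz)
  have hsupp : tsupport (𝒞.funAux ρ) ⊆ closedBall 0 (Fintype.card (Fin n)) :=
    Torus.tsupport_subset_closedBall_of_openCube (((tsupport_smul_subset_left _ _).trans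
      𝒞.tsupport_subset).trans (closedBall_cubeCenter_subset 𝒞.ρ'_lt))
  exact Torus.isSmooth_periodize hs hsupp

omit [IsManifold 𝓘(ℝ, E) ∞ M] in
/-- **Transfer of function multiples**: for a form supported in the chart preimage of the inner
cube region `K_ρ`, `T(ρ β) = ρ̃ • T(β)`. [cite: WarnerGTM94, 6.33] -/
theorem MForm.toTorus_fun_smul (ι : (E [⋀^Fin k]→L[ℝ] F) →L[ℝ] V) (ρ : M → ℝ) {β : MForm 𝓘(ℝ, E) M F k}
    (hK : ∀ x, β x ≠ 0 → x ∈ (extChartAt 𝓘(ℝ, E) p).source ∧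
      extChartAt 𝓘(ℝ, E) p x ∈ cubeRegion A (extChartAt 𝓘(ℝ, E) p p) 𝒞.ρ) :
    MForm.toTorus p A ι (ρ • β) = fun x ↦ 𝒞.torusFun ρ x • MForm.toTorus p A ι β x := by
  funext x
  rw [𝒞.torusFun_apply]
  by_cases hx : MForm.toTorus p A ι β x = 0
  · rw [hx, smul_zero, MForm.toTorus_apply, MForm.chartRep_fun_smul]
    rw [MForm.toTorus_apply] at hx
    simp only [map_smul, hx, smul_zero]
  · rw [𝒞.eq_one _ (MForm.toTorus_support ι hK x hx), one_smul, Complex.coe_smul, MForm.toTorus_apply,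
      MForm.toTorus_apply, MForm.chartRep_fun_smul, map_smul]

end Literature.Geometry.Kaehler
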